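import Summits.RiemannHypothesis.RiemannHypothesis.Theorems.HandoffTailDichotomy
import Summits.RiemannHypothesis.RiemannHypothesis.Theorems.HandoffSchur
import HarnessLib

/-!
# The EDGE-LAYER law `EDGE(q, κ)` of HANDOFF-STATEMENT §E-2, typed: RH-implied at `κ = 1`, and CUMULATIVE for every `κ`

Cell `rh-explicit`, TRACK «HANDOFF», seat handoff-theory-1 (definitions + logic), gen3.  Companion text:
`HOME/handoff/HANDOFF-STATEMENT.md` §C, §E-2 (v1.3 correction, credit idea-1 gen2 §0 (5)) and §I.5 (the row «EDGE(q,κ) as written (md)»,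
the last per-window statement of the classification that was not a Lean `Prop`).  Builds on prove-2's `HandoffWindow.lean` /
`HandoffSchur.lean` (deficit, contribution, translation invariance), this seat's `HandoffDecompositionConsequences.lean`
(`deficit_eq_of_narrow`, `contribution_eq_two_mul`) and `HandoffTailDichotomy.lean` (the cumulative-tail tool).

HONEST FRAMING.  Nothing here is a step towards RH.  `EDGE(q, κ)` says: on the window of `q`, a deficit of the OLD form can only
be bought with mass in BOTH edge layers `A = (log q − t, t]`, `B = [−t, t − log q)`, at price `κ·w_q` per unit geometric-mean mass:
`deficit_q(g) ≤ κ · w_q · ‖g|_A‖₂ · ‖g|_B‖₂`, `w_q = 2 log q/√q`.  PROVED here: (1) the product-form layer bound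
`|k_g(log q)| ≤ ‖g|_A‖₂‖g|_B‖₂` (Cauchy–Schwarz on the exact overlap; sharper than file B's `½‖g‖₂²`), hence `H(q) → EDGE(q, 1)`
(`HandoffH.edgeLaw`); (2) **`EDGE(q, κ) → WeilPositivityOn((log q)/2)` for EVERY `κ`** (`weilPositivityOn_of_handoffEdgeLaw`): a function
of the old cone, translated to the right end of the window, has NO mass in `B`, so the law gives it deficit `≤ 0`, and the forms are
translation invariant — the law is CUMULATIVE (§E-2 correction, paper proof there; now kernel-checked); (3) hence `H(q) → EDGE(q,1) →
H` of every smaller prime, `RH ↔ ∀ q prime, EDGE(q, q⁺, κ_q)` (`κ_q ≥ 1`), and the TAIL form `∃ q₀ ∀ q ≥ q₀` is already RH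
(`HandoffTailDichotomy.riemannHypothesis_iff_exists_forall_of_cumulative`) — no discount.

References: Bombieri 2000 §4 Lemma 2 (the method of the layer bound) [Bombieri2000Weil]; this track: HANDOFF-STATEMENT §C/§E-2,
idea-1 IDEAS-prolate §0 (5), prove-1 ATTEMPT-1 §2 (edge-layer lemma).
-/

set_option linter.dupNamespace false  -- the mandated namespace repeats `RiemannHypothesis`

noncomputable section

open Set MeasureTheory Literature.NumberTheory.LFunctions
open scoped ComplexConjugate

namespace Summit.RiemannHypothesis.RiemannHypothesis.Theorems.HandoffDecomposition

variable {g : ℝ → ℂ} {q q' : ℕ} {κ : ℝ}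

/-! ## §1  The product-form layer bound `|k_g(L)| ≤ ‖g|_A‖₂ ‖g|_B‖₂` -/

/-- Weighted layer bound: for `tsupport g ⊆ [−t, t]`, any lag `L` and any weight `s > 0`,
`|k_g(L)| ≤ (s·m_A + s⁻¹·m_B)/2` with the layer masses `m_A = ∫_{u > L−t} |g|²` (= the mass of `g` on `A = (L−t, t]`) and
`m_B = ∫_{u < t−L} |g|²` (= the mass on `B = [−t, t−L)`): the integrand `g(u)·conj g(u−L)` lives on `u ∈ A`, `u − L ∈ B`, and
`2|a||b| ≤ s|a|² + s⁻¹|b|²`. [cite: Bombieri2000Weil, §4 Lemma 2 (method); this track HANDOFF-STATEMENT §A.4] -/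
theorem norm_weilConv_weilReflect_le_layers (hg : IsWeilTest g) {t : ℝ} (hsupp : tsupport g ⊆ Icc (-t) t) (L : ℝ)
    {s : ℝ} (hs : 0 < s) :
    ‖weilConv g (weilReflect g) L‖ ≤
      (s * (∫ u in Ioi (L - t), ‖g u‖ ^ 2) + s⁻¹ * ∫ u in Iio (t - L), ‖g u‖ ^ 2) / 2 := by
  have hsup := support_subset_Ioo_of_tsupport_subset_Icc hg.1.continuous hsupp
  have hzero : ∀ x, x ∉ Ioo (-t) t → g x = 0 := fun x hx ↦ Function.notMem_support.1 fun h ↦ hx (hsup h)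
  set gA : ℝ → ℂ := (Ioi (L - t)).indicator g with hgA
  set gB : ℝ → ℂ := (Iio (t - L)).indicator g with hgB
  have hsplit : ∀ u, g u * weilReflect g (L - u) = gA u * conj (gB (u - L)) := by
    intro u
    simp only [weilReflect, neg_sub, hgA, hgB, Set.indicator_apply, mem_Ioi, mem_Iio]
    by_cases hu : L - t < u
    · rw [if_pos hu]
      by_cases hu2 : u - L < t - L
      · rw [if_pos hu2]
      · rw [if_neg hu2]
        have hgu : g u = 0 := hzero u fun h ↦ by have := (mem_Ioo.1 h).2; linarith
        simp [hgu]
    · rw [if_neg hu]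
      have hgu : g (u - L) = 0 := hzero (u - L) fun h ↦ by have := (mem_Ioo.1 h).1; linarith
      simp [hgu]
  have h2 : Integrable fun u : ℝ ↦ ‖g u‖ ^ 2 := hg.integrable_norm_sq
  have hAsq : (fun u : ℝ ↦ ‖gA u‖ ^ 2) = (Ioi (L - t)).indicator (fun u ↦ ‖g u‖ ^ 2) := by
    funext u; simp only [hgA, Set.indicator_apply, mem_Ioi]; split_ifs <;> simp
  have hBsq : (fun u : ℝ ↦ ‖gB u‖ ^ 2) = (Iio (t - L)).indicator (fun u ↦ ‖g u‖ ^ 2) := by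
    funext u; simp only [hgB, Set.indicator_apply, mem_Iio]; split_ifs <;> simp
  have hA2 : Integrable fun u : ℝ ↦ ‖gA u‖ ^ 2 := by rw [hAsq]; exact h2.indicator measurableSet_Ioi
  have hB2 : Integrable fun u : ℝ ↦ ‖gB u‖ ^ 2 := by rw [hBsq]; exact h2.indicator measurableSet_Iio
  have hB2' : Integrable fun u : ℝ ↦ ‖gB (u - L)‖ ^ 2 := hB2.comp_sub_right L
  have hmA : (∫ u in Ioi (L - t), ‖g u‖ ^ 2) = ∫ u, ‖gA u‖ ^ 2 := by
    rw [hAsq, integral_indicator measurableSet_Ioi]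
  have hmB : (∫ u in Iio (t - L), ‖g u‖ ^ 2) = ∫ u, ‖gB u‖ ^ 2 := by
    rw [hBsq, integral_indicator measurableSet_Iio]
  rw [weilConv_apply, hmA, hmB]
  calc ‖∫ u : ℝ, g u * weilReflect g (L - u)‖
      ≤ ∫ u : ℝ, ‖g u * weilReflect g (L - u)‖ := norm_integral_le_integral_norm _
    _ ≤ ∫ u : ℝ, (s * ‖gA u‖ ^ 2 + s⁻¹ * ‖gB (u - L)‖ ^ 2) / 2 := by
        refine integral_mono_of_nonneg (Filter.Eventually.of_forall fun _ ↦ norm_nonneg _)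
          (((hA2.const_mul s).add (hB2'.const_mul s⁻¹)).div_const 2) (Filter.Eventually.of_forall fun u ↦ ?_)
        simp only [hsplit u, norm_mul, Complex.norm_conj]
        -- `2ab ≤ s a² + s⁻¹ b²`
        set a : ℝ := ‖gA u‖
        set b : ℝ := ‖gB (u - L)‖
        set w : ℝ := s⁻¹ with hw
        have hw1 : s * w = 1 := mul_inv_cancel₀ hs.ne'
        have hw2 : w * w * s = w := by rw [mul_assoc, mul_comm w s, hw1, mul_one]
        have hexp : s * (a - w * b) ^ 2 = s * a ^ 2 - 2 * (a * b) + w * b ^ 2 := by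
          linear_combination (-2 * a * b) * hw1 + b ^ 2 * hw2
        have key : 0 ≤ s * (a - w * b) ^ 2 := by positivity
        linarith
    _ = (s * (∫ u : ℝ, ‖gA u‖ ^ 2) + s⁻¹ * ∫ u : ℝ, ‖gB u‖ ^ 2) / 2 := by
        rw [integral_div, integral_add (hA2.const_mul s) (hB2'.const_mul s⁻¹), integral_const_mul,
          integral_const_mul, integral_sub_right_eq_self (fun u : ℝ ↦ ‖gB u‖ ^ 2) L]

/-- AM–GM in «for every weight» form: if `d ≤ (s·a + s⁻¹·b)/2` for all `s > 0` (`a, b ≥ 0`), then `d ≤ √a·√b`. [folklore] -/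
theorem le_sqrt_mul_sqrt_of_forall_weight {d a b : ℝ} (ha : 0 ≤ a) (hb : 0 ≤ b)
    (h : ∀ s : ℝ, 0 < s → d ≤ (s * a + s⁻¹ * b) / 2) : d ≤ Real.sqrt a * Real.sqrt b := by
  rcases ha.eq_or_lt with rfl | ha'
  · -- a = 0: d ≤ b/(2s) for all s > 0, so d ≤ 0
    rw [Real.sqrt_zero, zero_mul]
    refine le_of_forall_pos_lt_add fun ε hε ↦ ?_
    have := h (b / ε + 1) (by positivity)
    have hlt : (b / ε + 1)⁻¹ * b < 2 * ε := by
      rw [inv_mul_lt_iff₀ (by positivity)]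
      nlinarith [mul_pos hε hε, div_mul_cancel₀ b hε.ne']
    linarith
  rcases hb.eq_or_lt with rfl | hb'
  · rw [Real.sqrt_zero, mul_zero]
    refine le_of_forall_pos_lt_add fun ε hε ↦ ?_
    have := h (ε / (a + 1)) (by positivity)
    have hlt : ε / (a + 1) * a < 2 * ε := by
      rw [div_mul_eq_mul_div, div_lt_iff₀ (by positivity)]
      nlinarith
    linarith
  · have hsa : 0 < Real.sqrt a := Real.sqrt_pos.2 ha'
    have hsb : 0 < Real.sqrt b := Real.sqrt_pos.2 hb'
    have := h (Real.sqrt b / Real.sqrt a) (by positivity)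
    have e1 : Real.sqrt b / Real.sqrt a * a = Real.sqrt a * Real.sqrt b := by
      rw [div_mul_eq_mul_div, div_eq_iff hsa.ne']
      nlinarith [Real.mul_self_sqrt ha]
    have e2 : (Real.sqrt b / Real.sqrt a)⁻¹ * b = Real.sqrt a * Real.sqrt b := by
      rw [inv_div, div_mul_eq_mul_div, div_eq_iff hsb.ne']
      nlinarith [Real.mul_self_sqrt hb]
    rw [e1, e2] at this
    linarith

/-- **The product-form layer bound** (HANDOFF-STATEMENT §A.4/§C): for `tsupport g ⊆ [−t, t]` and any lag `L`,
`|k_g(L)| ≤ ‖g|_A‖₂ · ‖g|_B‖₂` with `A = (L−t, t]`, `B = [−t, t−L)` (masses written as half-line integrals, equal to the layer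
masses by the support). Sharpens file B's `norm_weilConv_weilReflect_le_half`. [cite: Bombieri2000Weil, §4 Lemma 2 (method)] -/
theorem norm_weilConv_weilReflect_le_sqrt_mul_sqrt (hg : IsWeilTest g) {t : ℝ} (hsupp : tsupport g ⊆ Icc (-t) t) (L : ℝ) :
    ‖weilConv g (weilReflect g) L‖ ≤
      Real.sqrt (∫ u in Ioi (L - t), ‖g u‖ ^ 2) * Real.sqrt (∫ u in Iio (t - L), ‖g u‖ ^ 2) :=
  le_sqrt_mul_sqrt_of_forall_weight (integral_nonneg fun _ ↦ by positivity) (integral_nonneg fun _ ↦ by positivity)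
    fun _ hs ↦ norm_weilConv_weilReflect_le_layers hg hsupp L hs

/-! ## §2  The edge-layer law -/

/-- **`EDGE(q, q′, κ)`, the edge-layer law of HANDOFF-STATEMENT §E-2** (typed): for every half-width `t ∈ [(log q)/2, (log q′)/2]`
and every test function `g ∈ C(t)`, the deficit of the OLD form `Q_{S_q}` is at most `κ · w_q · ‖g|_A‖₂ · ‖g|_B‖₂`, where
`w_q = 2 log q/√q` and `A = (log q − t, t]`, `B = [−t, t − log q)` are the two EDGE LAYERS of the window (the only part of `g` the
atom `q` sees); the layer masses are written as the half-line integrals `∫_{u > log q − t}|g|²`, `∫_{u < t − log q}|g|²`, which is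
the same thing because `tsupport g ⊆ [−t, t]`.  A statement of THIS track (slot E-2), not a literature fact; RH-implied at `κ = 1`,
CUMULATIVE for every `κ` (below). [this track (theory-1 gen3), HANDOFF-STATEMENT.md §E-2] -/
def HandoffEdgeLaw (q q' : ℕ) (κ : ℝ) : Prop :=
  ∀ t ∈ Icc (Real.log q / 2) (Real.log q' / 2), ∀ g : ℝ → ℂ, IsWeilTest g → tsupport g ⊆ Icc (-t) t →
    Handoff.deficit q g ≤ κ * (2 * Real.log q / Real.sqrt q) *
      (Real.sqrt (∫ u in Ioi (Real.log q - t), ‖g u‖ ^ 2) * Real.sqrt (∫ u in Iio (t - Real.log q), ‖g u‖ ^ 2))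

/-- **`H(q) → EDGE(q, q⁺, κ)` for every `κ ≥ 1`**: `deficit ≤ contribution = −w_q Re k_g(log q) ≤ w_q |k_g(log q)| ≤
w_q ‖g|_A‖‖g|_B‖`. [this track (theory-1 gen3); HANDOFF-STATEMENT §C] -/
theorem HandoffH.edgeLaw (h : HandoffH q) (hκ : 1 ≤ κ) : HandoffEdgeLaw q (nextPrime q) κ := by
  intro t ht g hg hsupp
  have hd : Handoff.deficit q g ≤ Handoff.contribution q g := h t ht g hg hsupp
  rw [contribution_eq_two_mul] at hd
  have hw : 0 ≤ 2 * Real.log q / Real.sqrt q := by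
    have := Real.log_natCast_nonneg q; positivity
  have hk := norm_weilConv_weilReflect_le_sqrt_mul_sqrt hg hsupp (Real.log q)
  have hre : -(weilConv g (weilReflect g) (Real.log q)).re ≤ ‖weilConv g (weilReflect g) (Real.log q)‖ := by
    have := Complex.abs_re_le_norm (weilConv g (weilReflect g) (Real.log q))
    linarith [neg_abs_le (weilConv g (weilReflect g) (Real.log q)).re]
  have hP : 0 ≤ Real.sqrt (∫ u in Ioi (Real.log q - t), ‖g u‖ ^ 2) *
      Real.sqrt (∫ u in Iio (t - Real.log q), ‖g u‖ ^ 2) := by positivity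
  calc Handoff.deficit q g ≤ -(2 * Real.log q / Real.sqrt q * (weilConv g (weilReflect g) (Real.log q)).re) := hd
    _ ≤ 2 * Real.log q / Real.sqrt q * ‖weilConv g (weilReflect g) (Real.log q)‖ := by
        rw [← mul_neg]; exact mul_le_mul_of_nonneg_left hre hw
    _ ≤ 1 * (2 * Real.log q / Real.sqrt q) * (Real.sqrt (∫ u in Ioi (Real.log q - t), ‖g u‖ ^ 2) *
          Real.sqrt (∫ u in Iio (t - Real.log q), ‖g u‖ ^ 2)) := by
        rw [one_mul]; exact mul_le_mul_of_nonneg_left hk hw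
    _ ≤ κ * (2 * Real.log q / Real.sqrt q) * (Real.sqrt (∫ u in Ioi (Real.log q - t), ‖g u‖ ^ 2) *
          Real.sqrt (∫ u in Iio (t - Real.log q), ‖g u‖ ^ 2)) := by gcongr

/-- **`EDGE` is CUMULATIVE: `EDGE(q, q′, κ) → WeilPositivityOn((log q)/2)`** for a prime `q ≤ q′` and EVERY `κ` (HANDOFF-STATEMENT
§E-2 correction, idea-1 gen2 §0 (5)): translate `u ∈ C((log q)/2)` by `c = (log q′)/2 − (log q)/2 ≥ 0` to the right end of the window;
the translate has no mass in the left layer `B`, so the law gives it deficit `≤ 0`; the semilocal form is translation invariant and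
equals Weil's form on `C((log q)/2)`. [this track (theory-1 gen3); HANDOFF-STATEMENT §C (translation argument)] -/
theorem weilPositivityOn_of_handoffEdgeLaw (hq : q.Prime) (hqq' : q ≤ q') (hE : HandoffEdgeLaw q q' κ) :
    WeilPositivityOn (Real.log q / 2) := by
  intro u hu hus
  set L : ℝ := Real.log q with hL
  set t : ℝ := Real.log q' / 2 with ht
  set c : ℝ := t - L / 2 with hc
  have hq0 : (0 : ℝ) < q := by exact_mod_cast hq.pos
  have hc0 : 0 ≤ c := by
    have := Real.log_le_log hq0 (show (q : ℝ) ≤ q' by exact_mod_cast hqq'); simp only [hc, ht, hL]; linarith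
  -- the translate `g(x) = u(x − c)`, supported in `[t − L, t] ⊆ [−t, t]`
  set g : ℝ → ℂ := fun x ↦ u (x - c) with hg_def
  have hg : IsWeilTest g := by
    have := Handoff.isWeilTest_recentre hu (-c)
    simpa [hg_def, sub_eq_add_neg] using this
  have hgs' : tsupport g ⊆ Icc (t - L) t := by
    intro x hx
    have hx' : x - c ∈ tsupport u := by
      have hcont : Continuous fun x : ℝ ↦ x - c := continuous_id.sub continuous_const
      exact Handoff.tsupport_comp_subset_preimage_of_continuous u hcont hx
    have := hus hx'
    simp only [mem_Icc] at this ⊢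
    exact ⟨by linarith [this.1, hc], by linarith [this.2, hc]⟩
  have hLt : L / 2 ≤ t := by linarith
  have hgs : tsupport g ⊆ Icc (-t) t := hgs'.trans (Icc_subset_Icc (by linarith [Real.log_natCast_nonneg q]) le_rfl)
  -- no mass in the left layer
  have hB : (∫ x in Iio (t - L), ‖g x‖ ^ 2) = 0 := by
    refine setIntegral_eq_zero_of_forall_eq_zero fun x hx ↦ ?_
    have hx' : x ∉ tsupport g := fun h ↦ by have := (hgs' h).1; exact absurd this (not_le.2 hx)
    simp [image_eq_zero_of_notMem_tsupport hx']
  have hdef := hE t ⟨hLt, le_rfl⟩ g hg hgs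
  rw [hB, Real.sqrt_zero, mul_zero, mul_zero] at hdef
  -- deficit q g = deficit q u = −Re Q(u)
  have htr : Handoff.deficit q g = Handoff.deficit q u := by
    unfold Handoff.deficit; rw [hg_def, Handoff.weilSemilocalQuadratic_translate]
  rw [htr, deficit_eq_of_narrow hq hu hus] at hdef
  linarith

/-- **SANDWICH**: for a prime `q` and `κ ≥ 1`, `H(q) → EDGE(q, q⁺, κ) → WeilPositivityOn((log q)/2)` (= `H` of the previous prime).
[this track (theory-1 gen3)] -/
theorem handoffEdgeLaw_sandwich (hq : q.Prime) (hκ : 1 ≤ κ) :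
    (HandoffH q → HandoffEdgeLaw q (nextPrime q) κ) ∧ (HandoffEdgeLaw q (nextPrime q) κ → WeilPositivityOn (Real.log q / 2)) :=
  ⟨fun h ↦ h.edgeLaw hκ, weilPositivityOn_of_handoffEdgeLaw hq (lt_nextPrime q).le⟩

/-- **`RH ↔ ∀ q prime, EDGE(q, q⁺, κ_q)`** for any schedule `κ_q ≥ 1`. [this track (theory-1 gen3); Bombieri2000Weil Thm. 2] -/
theorem riemannHypothesis_iff_forall_handoffEdgeLaw {κ : ℕ → ℝ} (hκ : ∀ q : ℕ, q.Prime → 1 ≤ κ q) :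
    Summit.RiemannHypothesis ↔ ∀ q : ℕ, q.Prime → HandoffEdgeLaw q (nextPrime q) (κ q) := by
  rw [riemannHypothesis_iff_forall_handoffH]
  refine ⟨fun h q hq ↦ (h q hq).edgeLaw (hκ q hq), fun h P hP ↦ ?_⟩
  rw [handoffH_iff_weilPositivityOn hP]
  exact weilPositivityOn_of_handoffEdgeLaw (nextPrime_prime P) (lt_nextPrime _).le (h _ (nextPrime_prime P))

/-- **The tail form is RH too**: `RH ↔ ∃ q₀, ∀ primes q ≥ q₀, EDGE(q, q⁺, κ_q)` (`κ_q ≥ 1`) — by the cumulative-tail tool of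
`HandoffTailDichotomy.lean`. [this track (theory-1 gen3)] -/
theorem riemannHypothesis_iff_exists_forall_handoffEdgeLaw {κ : ℕ → ℝ} (hκ : ∀ q : ℕ, q.Prime → 1 ≤ κ q) :
    Summit.RiemannHypothesis ↔ ∃ q₀ : ℕ, ∀ q : ℕ, q.Prime → q₀ ≤ q → HandoffEdgeLaw q (nextPrime q) (κ q) :=
  riemannHypothesis_iff_exists_forall_of_cumulative
    (fun hRH q hq ↦ (handoffH_of_riemannHypothesis hRH hq).edgeLaw (hκ q hq))
    (fun q hq hE ↦ weilPositivityOn_of_handoffEdgeLaw hq (lt_nextPrime q).le hE)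

end Summit.RiemannHypothesis.RiemannHypothesis.Theorems.HandoffDecomposition

end
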